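import Summits.BirchSwinnertonDyer.BirchSwinnertonDyer.Theorems.AdditiveKolyvaginRoadManinFrameResidueProperRTameTwistFull57
import Summits.BirchSwinnertonDyer.BirchSwinnertonDyer.Theorems.AdditiveKolyvaginRoadManinFrameOffExceptionOnCurve
import Summits.BirchSwinnertonDyer.Rank1Residual.Additive.GordTorsionFiveSeven
import HarnessLib

/-!
# Route `AdditiveKolyvaginRoad`, crux `ManinFrameResidueProperR` (stmt-BirchSwinnertonDyer-20709), line
# `tame-twist`, stub S57 (`p ∈ {5, 7}`): the Kosters–Pannekoek exception is EXCLUDED on the locus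
# `4 ≤ v_p(Δ_min)` (potentially good), class-wide GRANTED Dokchitser–Dokchitser — `--supports`, helper

Cell `pub/bsd-wall`, seat `bsd-wall-manin-p1` g4. THEOREMS ONLY. The member theorem
`exists_member_not_dvd_c_of_tameTwist57` (`…RTameTwistFull57`, p579959) carries the class-wide hypothesis
«no member has a `ℚ_p`-rational point of order `p`». Here it is DISCHARGED from curve-level data of the frame
curve `W`: `0 ≤ v_p(j(W))` (potentially good) and `4 ≤ v_p(Δ_min(W))`. Ingredients (all in the tree): under
`E[p]` irreducible a cyclic `ℚ`-isogeny `W → W′` has degree prime to `p`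
(`X11b.not_dvd_degree_of_isCyclic_of_irr`); Dokchitser–Dokchitser 2015 Thm. 5.1 (1) (named fact
`dokchitser_padicValInt_minimalDiscriminantInt_eq_of_isogeny_of_not_dvd_degree` = the crux binder
`DokchitserIsogenyMinimalDiscriminant`) then gives `v_p(Δ_min(W′)) = v_p(Δ_min(W))`; and Mazur's Step 1 pushed
to `p ≥ 5` (`Rank1Residual.Additive.eq_zero_of_prime_nsmul_eq_zero_of_addv_of_four_le`, PROVED in the tree)
gives `W′(ℚ_p)[p] = 0` from `Addv W′ p` and `4 ≤ v_p(Δ_min(W′))`. Consistent with the census KP57-CENSUS-v1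
(evidence #12 on the crux item): every Kosters–Pannekoek-exceptional cell has Kodaira type II/III at 5, II at 7.
So, GRANTED the `p ≥ 5` Kato–Kosters–Pannekoek fact `hK` and the crux's own binder `dd`, stub S57 holds at
every frame whose curve `W` is potentially good at `p` with `v_p(Δ_min(W)) ≥ 4` (Kodaira IV, I₀*, IV*, III*,
II*); what remains of S57 is the locus `v_p(Δ_min(W)) ∈ {2, 3}` (types II, III) with a `ℚ_p`-rational point of
order `p`, and the potentially multiplicative frames (not treated here). Nothing is closed by this file.
-/

set_option autoImplicit false
set_option linter.dupNamespace false

noncomputable section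

open scoped Classical

open WeierstrassCurve NumberField Literature.NumberTheory.EllipticCurves
  Literature.NumberTheory.EllipticCurves.ModularForms
  Literature.NumberTheory.EllipticCurves.Rank1Residual
  Literature.NumberTheory.DiophantineGeometry IsDedekindDomain Rat.HeightOneSpectrum
  Summit.BirchSwinnertonDyer.Rank1Residual Summit.BirchSwinnertonDyer.Rank1Residual.Additive

namespace Summit.BirchSwinnertonDyer.BirchSwinnertonDyer.Theorems.ManinFrameResidueProperRTameTwist

section FourLe

variable {p : ℕ} [hp : Fact p.Prime]

/-- **No member has a `ℚ_p`-rational point of order `p`, from curve-level data of the frame curve.** For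
`W/ℚ` globally minimal, additive at `p ≥ 5`, `E[p]` irreducible, potentially good at `p` (`0 ≤ v_p(j)`) with
`4 ≤ v_p(Δ_min(W))`, GRANTED Dokchitser–Dokchitser 2015 Thm. 5.1 (1): every globally minimal `W′ ∼ W` has
`W′(ℚ_p)[p] = 0` (cyclic isogeny of degree prime to `p`; `v_p(Δ_min)` is preserved; Mazur's Step 1 at
`p ≥ 5`). [cite: DokchitserDokchitser2015LocalInvariants, Thm. 5.1 (1) and Table 1]
[cite: Mazur1977, Ch. III §5, Step 1, p. 158] -/
theorem forall_member_noPTorsion_of_four_le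
    (hDD : dokchitser_padicValInt_minimalDiscriminantInt_eq_of_isogeny_of_not_dvd_degree)
    (W : WeierstrassCurve ℚ) [W.IsElliptic] [W.IsGloballyMinimal] (hp5 : 5 ≤ p) (hadd : Addv W p)
    (hirr : Irr W p) (hj : 0 ≤ padicValRat p W.j) (hv : 4 ≤ padicValInt p W.minimalDiscriminantInt)
    (W' : WeierstrassCurve ℚ) [W'.IsElliptic] [W'.IsGloballyMinimal] (hiso : IsIsogenous W W')
    (P : (W'.baseChange ℚ_[p]).toAffine.Point) (hP : p • P = 0) : P = 0 := by
  obtain ⟨ψ, hψ⟩ := hiso.exists_isCyclic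
  have hdeg : ¬ p ∣ ψ.degree := X11b.not_dvd_degree_of_isCyclic_of_irr ψ hψ hp.out hirr
  have hv' : 4 ≤ padicValInt p W'.minimalDiscriminantInt := by
    rw [← hDD W W' ψ p hp.out hdeg hj]; exact hv
  have hadd' : Addv W' p := (X2.addv_iff_of_isIsogenous (p := p) hiso).mp hadd
  exact Summit.BirchSwinnertonDyer.Rank1Residual.Additive.eq_zero_of_prime_nsmul_eq_zero_of_addv_of_four_le
    (W := W') (p := p) hp5 hadd' hv' hP

/-- **At an AKR residue frame with `p ∈ {5, 7}`, potentially good with `v_p(Δ_min) ≥ 4`: a member with a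
Manin-unit conductor-level datum**, GRANTED the `p ≥ 5` Kato–Kosters–Pannekoek fact `hK` and
Dokchitser–Dokchitser `hDD` (= the crux binder `DokchitserIsogenyMinimalDiscriminant`) — the class-wide
no-`p`-torsion hypothesis of `exists_member_not_dvd_c_of_tameTwist57` discharged by
`forall_member_noPTorsion_of_four_le`. [cite: KostersPannekoek2017, Thm. 1 and Cor. 2]
[cite: DokchitserDokchitser2015LocalInvariants, Thm. 5.1 (1)] -/
theorem exists_member_not_dvd_c_of_tameTwist57_of_four_le
    (hK : kato_neron_isIntegral_twistedSymbolSum_of_additive_five_le)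
    (hDD : dokchitser_padicValInt_minimalDiscriminantInt_eq_of_isogeny_of_not_dvd_degree)
    (hnf : exists_isNewformOf) (W : WeierstrassCurve ℚ) [W.IsElliptic] [W.IsGloballyMinimal]
    [NeZero (W.conductorNorm ℤ)] (hp57 : p = 5 ∨ p = 7) (hadd : Addv W p) (hirr : Irr W p)
    (hj : 0 ≤ padicValRat p W.j) (hv : 4 ≤ padicValInt p W.minimalDiscriminantInt) :
    ∃ (W₀ : WeierstrassCurve ℚ) (_ : W₀.IsElliptic) (_ : W₀.IsGloballyMinimal)
      (D₀ : ModularParametrizationData W₀ (W.conductorNorm ℤ)),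
      IsIsogenous W W₀ ∧ ¬ (p : ℤ) ∣ D₀.c := by
  have hp5 : 5 ≤ p := by rcases hp57 with rfl | rfl <;> norm_num
  exact exists_member_not_dvd_c_of_tameTwist57 hK hnf W hp57 hadd hirr
    (fun W' _ _ hiso P hP ↦ forall_member_noPTorsion_of_four_le hDD W hp5 hadd hirr hj hv W' hiso P hP)

/-- **The registered stub S57, VERBATIM binder list, on the starred/type-IV locus** — GRANTED `hK` (the
`p ≥ 5` Kato–Kosters–Pannekoek fact) and `hDD` (Dokchitser–Dokchitser, a binder of the crux itself): if the
frame curve `W` is potentially good at `p` with `4 ≤ v_p(Δ_min(W))` (Kodaira IV, I₀*, IV*, III*, II*), the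
conclusion of `stub_memberManinUnit_fiveSeven` holds. The remaining locus of S57 is `v_p(Δ_min(W)) ∈ {2, 3}`
(types II, III) — where the Kosters–Pannekoek exception `W(ℚ_p)[p] ≠ 0` can occur (census: 49 of 1 159
residue cells in range) — and the potentially multiplicative frames. Nothing is closed.
[cite: KostersPannekoek2017, Thm. 1 and Cor. 2] [cite: DokchitserDokchitser2015LocalInvariants, Thm. 5.1 (1)] -/
theorem stub_memberManinUnit_fiveSeven_of_kato57_of_four_le
    (hK : kato_neron_isIntegral_twistedSymbolSum_of_additive_five_le)
    (hDD : dokchitser_padicValInt_minimalDiscriminantInt_eq_of_isogeny_of_not_dvd_degree)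
    (hnf : Literature.NumberTheory.EllipticCurves.ModularForms.exists_isNewformOf)
    (W : WeierstrassCurve ℚ) [W.IsElliptic] [W.IsGloballyMinimal] (hp5 : 5 ≤ p) (hp11 : p < 11)
    [NeZero (W.conductorNorm ℤ)] (hadd : Addv W p) (hirr : Irr W p)
    (_hres : ((p < 11 ∨ ∃ (W' : WeierstrassCurve ℚ) (_ : W'.IsElliptic) (_ : W'.IsGloballyMinimal),
          IsIsogenous W W' ∧ TypeGOrd W' p ∧ padicValInt p W'.minimalDiscriminantInt ≤ 4) ∧
        (∃ (W' : WeierstrassCurve ℚ) (_ : W'.IsElliptic) (_ : W'.IsGloballyMinimal),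
          IsIsogenous W W' ∧ ∀ (v : HeightOneSpectrum ℤ) (n : ℕ), natGenerator v = p →
            W'.kodairaSymbolAt v ≠ KodairaSymbol.Istar n)))
    (_hall : (∀ (W' : WeierstrassCurve ℚ) [W'.IsElliptic] [W'.IsGloballyMinimal]
          (D' : ModularParametrizationData W' (W.conductorNorm ℤ)),
          IsIsogenous W W' → p ∣ D'.modularDegree))
    (hj : 0 ≤ padicValRat p W.j) (hv : 4 ≤ padicValInt p W.minimalDiscriminantInt) :
    ∃ (W₀ : WeierstrassCurve ℚ) (_ : W₀.IsElliptic) (_ : W₀.IsGloballyMinimal)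
        (D₀ : ModularParametrizationData W₀ (W.conductorNorm ℤ)),
        IsIsogenous W W₀ ∧ ¬ (p : ℤ) ∣ D₀.c := by
  have hpP : p.Prime := hp.out
  have hp57 : p = 5 ∨ p = 7 := by
    interval_cases p
    · exact Or.inl rfl
    · exact absurd hpP (by decide)
    · exact Or.inr rfl
    · exact absurd hpP (by decide)
    · exact absurd hpP (by decide)
    · exact absurd hpP (by decide)
  exact exists_member_not_dvd_c_of_tameTwist57_of_four_le hK hDD hnf W hp57 hadd hirr hj hv


/-! ### Appended: the sharp Kodaira form (same seat, same day). Mazur's Step 1 at `p ≥ 5` in the tree is sharper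
than `4 ≤ v_p(Δ_min)`: a `ℚ_p`-rational point of order `p` at an additive `p ≥ 5` forces
`(p = 5 ∧ v₅(Δ_min) ∈ {2, 3}) ∨ (p = 7 ∧ v₇(Δ_min) = 2)`
(`Rank1Residual.Additive.padicValInt_minimalDiscriminantInt_of_prime_zsmul_eq_zero_of_addv`). So the
Kosters–Pannekoek exception is excluded class-wide OFF Kodaira types II, III at `p = 5` and OFF type II at
`p = 7` (the census KP57-CENSUS-v1 found exceptional cells exactly there: 47 = III 41 + II 6 at `5`, 2 of
type II at `7`). -/

/-- **No member has a `ℚ_p`-rational point of order `p`, sharp Kodaira form.** For `W/ℚ` globally minimal,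
additive at `p ≥ 5`, `E[p]` irreducible, potentially good at `p`, with
`¬ ((p = 5 ∧ v_p(Δ_min(W)) ∈ {2, 3}) ∨ (p = 7 ∧ v_p(Δ_min(W)) = 2))`, GRANTED Dokchitser–Dokchitser: every
globally minimal `W′ ∼ W` has `W′(ℚ_p)[p] = 0`. [cite: DokchitserDokchitser2015LocalInvariants, Thm. 5.1 (1)]
[cite: Mazur1977, Ch. III §5, Step 1, p. 158] -/
theorem forall_member_noPTorsion_of_kodaira
    (hDD : dokchitser_padicValInt_minimalDiscriminantInt_eq_of_isogeny_of_not_dvd_degree)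
    (W : WeierstrassCurve ℚ) [W.IsElliptic] [W.IsGloballyMinimal] (hp5 : 5 ≤ p) (hadd : Addv W p)
    (hirr : Irr W p) (hj : 0 ≤ padicValRat p W.j)
    (hexc : ¬ ((p = 5 ∧ (padicValInt p W.minimalDiscriminantInt = 2 ∨
        padicValInt p W.minimalDiscriminantInt = 3)) ∨ (p = 7 ∧ padicValInt p W.minimalDiscriminantInt = 2)))
    (W' : WeierstrassCurve ℚ) [W'.IsElliptic] [W'.IsGloballyMinimal] (hiso : IsIsogenous W W')
    (P : (W'.baseChange ℚ_[p]).toAffine.Point) (hP : p • P = 0) : P = 0 := by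
  obtain ⟨ψ, hψ⟩ := hiso.exists_isCyclic
  have hdeg : ¬ p ∣ ψ.degree := X11b.not_dvd_degree_of_isCyclic_of_irr ψ hψ hp.out hirr
  have hv' : padicValInt p W'.minimalDiscriminantInt = padicValInt p W.minimalDiscriminantInt :=
    (hDD W W' ψ p hp.out hdeg hj).symm
  have hadd' : Addv W' p := (X2.addv_iff_of_isIsogenous (p := p) hiso).mp hadd
  by_contra hP0
  have h := Summit.BirchSwinnertonDyer.Rank1Residual.Additive.padicValInt_minimalDiscriminantInt_of_prime_zsmul_eq_zero_of_addv
    (W := W') (p := p) hp5 hadd' hP0 (by rw [natCast_zsmul]; exact hP)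
  rw [hv'] at h
  exact hexc h

/-- **At an AKR residue frame with `p ∈ {5, 7}`, potentially good, OFF Kodaira II/III at 5 and II at 7: a member
with a Manin-unit conductor-level datum**, GRANTED `hK` and `hDD`.
[cite: KostersPannekoek2017, Thm. 1 and Cor. 2] [cite: DokchitserDokchitser2015LocalInvariants, Thm. 5.1 (1)] -/
theorem exists_member_not_dvd_c_of_tameTwist57_of_kodaira
    (hK : kato_neron_isIntegral_twistedSymbolSum_of_additive_five_le)
    (hDD : dokchitser_padicValInt_minimalDiscriminantInt_eq_of_isogeny_of_not_dvd_degree)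
    (hnf : exists_isNewformOf) (W : WeierstrassCurve ℚ) [W.IsElliptic] [W.IsGloballyMinimal]
    [NeZero (W.conductorNorm ℤ)] (hp57 : p = 5 ∨ p = 7) (hadd : Addv W p) (hirr : Irr W p)
    (hj : 0 ≤ padicValRat p W.j)
    (hexc : ¬ ((p = 5 ∧ (padicValInt p W.minimalDiscriminantInt = 2 ∨
        padicValInt p W.minimalDiscriminantInt = 3)) ∨ (p = 7 ∧ padicValInt p W.minimalDiscriminantInt = 2))) :
    ∃ (W₀ : WeierstrassCurve ℚ) (_ : W₀.IsElliptic) (_ : W₀.IsGloballyMinimal)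
      (D₀ : ModularParametrizationData W₀ (W.conductorNorm ℤ)),
      IsIsogenous W W₀ ∧ ¬ (p : ℤ) ∣ D₀.c := by
  have hp5 : 5 ≤ p := by rcases hp57 with rfl | rfl <;> norm_num
  exact exists_member_not_dvd_c_of_tameTwist57 hK hnf W hp57 hadd hirr
    (fun W' _ _ hiso P hP ↦ forall_member_noPTorsion_of_kodaira hDD W hp5 hadd hirr hj hexc W' hiso P hP)

/-- **The registered stub S57, VERBATIM binder list, OFF Kodaira types II/III at `5` and II at `7`** (frame curve
potentially good at `p`), GRANTED `hK` (the `p ≥ 5` Kato–Kosters–Pannekoek fact) and `hDD` (Dokchitser–Dokchitser,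
a binder of the crux). What remains of S57: frames of Kodaira type II or III at `p = 5`, type II at `p = 7`
(where a `ℚ_p`-rational point of order `p` may exist: 49 of 1 159 residue cells in range), and potentially
multiplicative frames (excluded by the crux's «not all `Iₙ*`» clause anyway). Nothing is closed.
[cite: KostersPannekoek2017, Thm. 1 and Cor. 2] [cite: Mazur1977, Ch. III §5, Step 1, p. 158] -/
theorem stub_memberManinUnit_fiveSeven_of_kato57_of_kodaira
    (hK : kato_neron_isIntegral_twistedSymbolSum_of_additive_five_le)
    (hDD : dokchitser_padicValInt_minimalDiscriminantInt_eq_of_isogeny_of_not_dvd_degree)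
    (hnf : Literature.NumberTheory.EllipticCurves.ModularForms.exists_isNewformOf)
    (W : WeierstrassCurve ℚ) [W.IsElliptic] [W.IsGloballyMinimal] (hp5 : 5 ≤ p) (hp11 : p < 11)
    [NeZero (W.conductorNorm ℤ)] (hadd : Addv W p) (hirr : Irr W p)
    (_hres : ((p < 11 ∨ ∃ (W' : WeierstrassCurve ℚ) (_ : W'.IsElliptic) (_ : W'.IsGloballyMinimal),
          IsIsogenous W W' ∧ TypeGOrd W' p ∧ padicValInt p W'.minimalDiscriminantInt ≤ 4) ∧
        (∃ (W' : WeierstrassCurve ℚ) (_ : W'.IsElliptic) (_ : W'.IsGloballyMinimal),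
          IsIsogenous W W' ∧ ∀ (v : HeightOneSpectrum ℤ) (n : ℕ), natGenerator v = p →
            W'.kodairaSymbolAt v ≠ KodairaSymbol.Istar n)))
    (_hall : (∀ (W' : WeierstrassCurve ℚ) [W'.IsElliptic] [W'.IsGloballyMinimal]
          (D' : ModularParametrizationData W' (W.conductorNorm ℤ)),
          IsIsogenous W W' → p ∣ D'.modularDegree))
    (hj : 0 ≤ padicValRat p W.j)
    (hexc : ¬ ((p = 5 ∧ (padicValInt p W.minimalDiscriminantInt = 2 ∨
        padicValInt p W.minimalDiscriminantInt = 3)) ∨ (p = 7 ∧ padicValInt p W.minimalDiscriminantInt = 2))) :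
    ∃ (W₀ : WeierstrassCurve ℚ) (_ : W₀.IsElliptic) (_ : W₀.IsGloballyMinimal)
        (D₀ : ModularParametrizationData W₀ (W.conductorNorm ℤ)),
        IsIsogenous W W₀ ∧ ¬ (p : ℤ) ∣ D₀.c := by
  have hpP : p.Prime := hp.out
  have hp57 : p = 5 ∨ p = 7 := by
    interval_cases p
    · exact Or.inl rfl
    · exact absurd hpP (by decide)
    · exact Or.inr rfl
    · exact absurd hpP (by decide)
    · exact absurd hpP (by decide)
    · exact absurd hpP (by decide)
  exact exists_member_not_dvd_c_of_tameTwist57_of_kodaira hK hDD hnf W hp57 hadd hirr hj hexc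

end FourLe

end Summit.BirchSwinnertonDyer.BirchSwinnertonDyer.Theorems.ManinFrameResidueProperRTameTwist

end
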